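import Summits.QuantumFields.YangMills.Theorems.UnitScaleTiltProp7CombDefectRowsOfRegPr
import HarnessLib

/-!
# Route `UnitScaleTilt`, crux K1 «MinimiserStabilityRegPr» (stmt-QuantumFields-19200), route-R E′ (A′), package P-A4 CURVED, FILE (b-ℤ) — THE COMPETITOR ON THE PULLBACK:
# for print's iterated gauge-parameter average `Q′_k(U₀♯)` ([B9] (3.19), lit `QprimeIter … (bgT …)`, the letters of `IsLandauPrint`) the bump×comb-rotated competitor `G` with the
# re-targeted block datum `ν y := M_y⁻¹(Q′_k g)(y)` has the SAME `k`-fold averages as `g` — EXACTLY, at every level-`k` site — and its datum is bounded by the block means of `g`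

Cell `ym3-torus`, width seat `ym3-torus-px11` (g5; explicit-unit helper).  THEOREMS ONLY (0 `def`, 0 `sorry`); `--supports stmt-QuantumFields-19200`, count-neutral.  YM₃ on T³ is a
ladder rung (R3), not the Clay problem; nothing here claims the stub, the crux, `bern_P`, d = 4 or the mass gap.  Pens of record (px12 g5 02:39Z ∕ ★★OWNER g29 RULING №16 ∕ px19 g5 03:11Z
cut): V1 + F1-core + B-β + (b-T) = px19, F2 + (b-ℤ) = px11, F3 + (a) = px12.

THE PRINT.  [Balaban1985BackgroundPropagators] (3.18)–(3.19) p. 393 (`(Q′(U)λ)(y) = Σ_{x∈B(y)} L⁻ᵈR(U(Γ_{y,x}))λ(x)`, `Q′_j(U) = Q′(Ūʲ⁻¹)⋯Q′(U)`), (3.21) p. 394 (`N(Q′) = ker Q′_k`);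
[Balaban1985Averaging] (78)–(80) p. 30 (the block geometry); [Balaban1985Variational] (21) p. 281.

WHY.  The curved crude slice (P-A4) compares `f ∈ ker R(U₀)` with ANY competitor in its `ker Q′_k(U₀)`-coset (px19 ✓p690789 variational principle ∕ px11 LOCATE (M1)).  The competitor is
`G(x) := φ(x)·R(σ_{y(x)}(x))⁻¹ ν(y(x))` (`σ_y` the comb axial gauge from the corner of the `k`-block `y(x)` of `x`, `φ` a bump), and `G − g ∈ ker Q′_k` iff the datum solves `M_y ν(y) =
(Q′_k g)(y)` with `M_y X := (Q′_k(φ•R(σ_y)⁻¹X))(y)` — invertible by Neumann because `‖M_y − m•1‖ ≤ θ(d,L)·2ε₀·m` (✓F2b (θ)+(θ′)) — and `Q′_k` is LOCAL (its value at `y` reads the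
`k`-block of `y` only).  This file proves the locality, the exact coset match given the inverse, the norm bound of `Q′_k`, the datum bound, and packages `M_y` as a continuous linear map
with the Neumann hypothesis `‖M_y − m•1‖ ≤ θ·2ε₀·m` at the member (so ✓⧗ px19 `exists_inverse_of_norm_sub_smul_one_le` applies under the L-only window `4θ(d,L)ε₀ ≤ 1`).

WHAT IS PROVED (ns `…Theorems.Prop7CombCompetitorPullback`; `T : ℕ → LSite d → LSite d → 𝔸ˣ` any transporters, `Q′_j := QprimeIter (zdBlocking d L) T j`).
* §1 ★`QprimeIter_congr_of_eqOn_blockSites` (LOCALITY), ★`norm_QprimeIter_le` (`‖Q′_j h z‖ ≤ (L⁻ᵈ)ʲ·Σ_{x∈Bʲ(z)}‖h x‖` for `U1` transporters); §1b `sum_blockSites_add`,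
  ★`QprimeIter_bgT_add` (TRANSLATION COVARIANCE), ★`QprimeIter_bgT_add_of_periodic` (PERIODICITY under the period lattice of background and argument).
* §2 ★★★`QprimeIter_competitor_eq` (EXACT COSET MATCH: free `Minv ν G` with defining hypotheses ⊢ `∀ y, Q′_k G y = Q′_k g y`), `QprimeIter_competitor_sub_eq_zero` (`Q′_k(G − g) = 0`), ★`norm_datum_le` (`‖ν y‖ ≤ μ·(L⁻ᵈ)ᵏ·Σ_{Bᵏ(y)}‖g‖`).
* §3 member (`Ṽ := pull (bgUnits F K U₀) x₀`, `U₀ ∈ RegPr(ε₀)`): ★★`exists_clm_combAvg_axial_of_regPr` — `∃ M : M₂ →L[ℂ] M₂, (∀ X, M X = Q′_k[Ṽ](φ•R(σ_y)⁻¹X)(y)) ∧ ‖M − (m:ℂ)•1‖ ≤ θ(d,L)·(2ε₀)·m`.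
HONEST SCOPE.  Averaging algebra + the F2b estimate; no claim of print beyond lit's certified (3.19)∕(3.32)∕(52)–(54).

References: T. Bałaban, CMP **99** (1985) 389–434 [Balaban1985BackgroundPropagators] ((3.18)–(3.21) pp.393–394); CMP **98** (1985) 17–51 [Balaban1985Averaging] ((78)–(80) p.30);
CMP **102** (1985) 277–309 [Balaban1985Variational] ((21) p.281).
-/

set_option autoImplicit false

noncomputable section

namespace Summit.QuantumFields.YangMills.Theorems.Prop7CombCompetitorPullback

open scoped Matrix.Norms.L2Operator BigOperators
open Finset
open Literature.MathematicalPhysics.QuantumFieldTheory.Balaban1983to89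
open Literature.MathematicalPhysics.QuantumFieldTheory.Balaban1983to89.T3ContinuumYM3Torus
open Literature.MathematicalPhysics.QuantumFieldTheory.Balaban1983to89.T3PrintedRegularMinimiser (RegPr)
open Literature.MathematicalPhysics.QuantumLattice (blockMap blockBase blockSites mem_blockSites_iff)
open B7Prop1Explicit renaming Site → LSite
open B7Prop1Explicit (e hol seg treeWord l1 axialFn gaugeAct U1 mem_U1 hol_mem)
open B7Prop2Explicit (avgIter pdev C0 c2' AvgClosed)
open B7Eq78Linearization (conjR conjR_apply QprimeIter zdBlocking Qprime Qprime_apply QprimeIter_succ QprimeIter_add QprimeIter_smul conjR_add conjR_smul conjR_smul_real)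
open B8Eq119TwistedAxial (bgT)
open B10Eq27TorusAxialLog (pull)
open T3SectALandauChart (bgUnits)
open B12Ineq417Flat (shiftCfg shiftCfg_apply hol_shiftCfg)
open B7TranslationCovariance (avgIter_shiftCfg)
open Summit.QuantumFields.YangMills.Theorems.Prop7CombAverageDefect (sum_blockSites_mul)
open Summit.QuantumFields.YangMills.Theorems.Prop7CombDefectRowsOfRegPr (norm_QprimeIter_axial_smul_sub_le_of_regPr QprimeIter_axial_eq_conjR)

/-! ## §1 Locality and the norm of the iterated average -/

section Generic

variable {𝔸 : Type*} [NormedRing 𝔸] [NormOneClass 𝔸] [NormedAlgebra ℂ 𝔸] [CompleteSpace 𝔸] {d : ℕ} {L : ℕ} (hL : 0 < L) (T : ℕ → LSite d → LSite d → 𝔸ˣ)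

omit [NormOneClass 𝔸] [CompleteSpace 𝔸] in
include hL in
/-- ★ **LOCALITY OF `Q′_j`**: the `j`-fold average at the level-`j` site `z` reads its argument on the `j`-block `{x | ⌊x∕Lʲ⌋ = z}` only. [cite: Balaban1985BackgroundPropagators, (3.18)–(3.19) p.393] -/
theorem QprimeIter_congr_of_eqOn_blockSites {h₁ h₂ : LSite d → 𝔸} :
    ∀ (j : ℕ) (z : LSite d), (∀ x ∈ blockSites (L ^ j) z, h₁ x = h₂ x) →
      QprimeIter (zdBlocking d L) T j h₁ z = QprimeIter (zdBlocking d L) T j h₂ z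
  | 0, z, h => by
    haveI : NeZero (L ^ 0) := ⟨by simp⟩
    have hz : z ∈ blockSites (L ^ 0) z := by
      rw [mem_blockSites_iff, pow_zero, Literature.MathematicalPhysics.QuantumLattice.blockMap_one]
    simpa using h z hz
  | j + 1, z, h => by
    haveI : NeZero L := ⟨hL.ne'⟩
    haveI : NeZero (L ^ j) := ⟨(pow_pos hL j).ne'⟩
    haveI : NeZero (L ^ (j + 1)) := ⟨(pow_pos hL _).ne'⟩
    rw [QprimeIter_succ, QprimeIter_succ]
    show Qprime (blockSites L z) (fun _ => ((L : ℝ) ^ d)⁻¹) (T j z) (QprimeIter (zdBlocking d L) T j h₁) =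
      Qprime (blockSites L z) (fun _ => ((L : ℝ) ^ d)⁻¹) (T j z) (QprimeIter (zdBlocking d L) T j h₂)
    rw [Qprime_apply, Qprime_apply]
    refine Finset.sum_congr rfl fun x' hx' => ?_
    rw [QprimeIter_congr_of_eqOn_blockSites j x' fun x hx => h x ?_]
    rw [mem_blockSites_iff] at hx hx' ⊢
    rw [pow_succ, ← B7BlockGeometry.blockMap_blockMap, hx, hx']

omit [CompleteSpace 𝔸] in
include hL in
/-- ★ **THE ITERATED AVERAGE IS A CONTRACTION ONTO BLOCK MEANS**: for transporters in `U1`, `‖(Q′_j h)(z)‖ ≤ (L⁻ᵈ)ʲ·Σ_{x ∈ Bʲ(z)} ‖h(x)‖`. [cite: Balaban1985BackgroundPropagators, (3.18)–(3.19) p.393] -/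
theorem norm_QprimeIter_le (hT1 : ∀ j z x', T j z x' ∈ U1 𝔸) (h : LSite d → 𝔸) :
    ∀ (j : ℕ) (z : LSite d), ‖QprimeIter (zdBlocking d L) T j h z‖ ≤ (((L : ℝ) ^ d)⁻¹) ^ j * ∑ x ∈ blockSites (L ^ j) z, ‖h x‖
  | 0, z => by
    haveI : NeZero (L ^ 0) := ⟨by simp⟩
    have hb : blockSites (1 : ℕ) z = {z} := by
      ext x; rw [mem_blockSites_iff, Finset.mem_singleton, Literature.MathematicalPhysics.QuantumLattice.blockMap_one]
    simp [hb]
  | j + 1, z => by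
    rw [QprimeIter_succ]
    show ‖Qprime (blockSites L z) (fun _ => ((L : ℝ) ^ d)⁻¹) (T j z) (QprimeIter (zdBlocking d L) T j h)‖ ≤ _
    rw [Qprime_apply, show L ^ (j + 1) = L ^ j * L from pow_succ L j, sum_blockSites_mul (pow_pos hL j) hL z (fun x => ‖h x‖), pow_succ,
      Finset.mul_sum]
    refine (norm_sum_le _ _).trans (Finset.sum_le_sum fun x' _ => ?_)
    have hLd : (0 : ℝ) ≤ ((L : ℝ) ^ d)⁻¹ := by positivity
    rw [norm_smul, Real.norm_of_nonneg hLd]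
    calc ((L : ℝ) ^ d)⁻¹ * ‖conjR (T j z x') (QprimeIter (zdBlocking d L) T j h x')‖
        ≤ ((L : ℝ) ^ d)⁻¹ * ((((L : ℝ) ^ d)⁻¹) ^ j * ∑ x ∈ blockSites (L ^ j) x', ‖h x‖) :=
          mul_le_mul_of_nonneg_left ((B8Ineq132.norm_conjR_le (hT1 j z x') _).trans (norm_QprimeIter_le hT1 h j x')) hLd
      _ = _ := by ring

/-! ## §1b Translation covariance and periodicity of `Q′_j` (the competitor row must hold at EVERY level-`k` site of `ℤᵈ`, not only on the period cell) -/

omit [NormOneClass 𝔸] [NormedAlgebra ℂ 𝔸] [CompleteSpace 𝔸] in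
/-- The `M`-block of `y + a` is the translate by `M•a` of the `M`-block of `y`: block sums reindex. [folklore] -/
theorem sum_blockSites_add (M : ℕ) (y a : LSite d) (g : LSite d → 𝔸) :
    ∑ x ∈ blockSites M (y + a), g x = ∑ x ∈ blockSites M y, g (x + (M : ℤ) • a) := by
  classical
  have hset : blockSites M (y + a) = (blockSites M y).image fun x => x + (M : ℤ) • a := by
    ext x
    simp only [blockSites, Finset.mem_image, Fintype.mem_piFinset, Finset.mem_range]
    constructor
    · rintro ⟨t, ht, rfl⟩
      refine ⟨blockBase M y + fun i => (t i : ℤ), ⟨t, ht, rfl⟩, ?_⟩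
      funext i; simp only [blockBase, Pi.add_apply, Pi.smul_apply, smul_eq_mul]; ring
    · rintro ⟨x', ⟨t, ht, rfl⟩, rfl⟩
      refine ⟨t, ht, ?_⟩
      funext i; simp only [blockBase, Pi.add_apply, Pi.smul_apply, smul_eq_mul]; ring
  rw [hset, Finset.sum_image fun x _ x' _ h => add_right_cancel h]

omit [NormOneClass 𝔸] in
/-- ★ **`Q′_j` IS TRANSLATION COVARIANT**: `(Q′_j[U] h)(y + a) = (Q′_j[t_{Lʲa}U](t_{Lʲa}h))(y)` — the block transporters of the translated background are the translated transporters
(lit `avgIter_shiftCfg`, `hol_shiftCfg`), and the blocks translate. [cite: Balaban1985Averaging, (43) p.24, p.19; Balaban1985BackgroundPropagators, (3.19) p.393] -/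
theorem QprimeIter_bgT_add (U : LSite d → Fin d → 𝔸ˣ) :
    ∀ (j : ℕ) (a : LSite d) (h : LSite d → 𝔸) (y : LSite d),
      QprimeIter (zdBlocking d L) (bgT L U) j h (y + a)
        = QprimeIter (zdBlocking d L) (bgT L (shiftCfg (((L : ℤ) ^ j) • a) U)) j (shiftCfg (((L : ℤ) ^ j) • a) h) y
  | 0, a, h, y => by simp [shiftCfg]
  | j + 1, a, h, y => by
    rw [QprimeIter_succ, QprimeIter_succ]
    show Qprime (blockSites L (y + a)) (fun _ => ((L : ℝ) ^ d)⁻¹) (bgT L U j (y + a)) (QprimeIter (zdBlocking d L) (bgT L U) j h) =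
      Qprime (blockSites L y) (fun _ => ((L : ℝ) ^ d)⁻¹) (bgT L (shiftCfg (((L : ℤ) ^ (j + 1)) • a) U) j y)
        (QprimeIter (zdBlocking d L) (bgT L (shiftCfg (((L : ℤ) ^ (j + 1)) • a) U)) j (shiftCfg (((L : ℤ) ^ (j + 1)) • a) h))
    rw [Qprime_apply, Qprime_apply, sum_blockSites_add]
    refine Finset.sum_congr rfl fun x _ => ?_
    -- the translated transporter
    have hW : shiftCfg ((L : ℤ) • a) (avgIter L U j) = avgIter L (shiftCfg (((L : ℤ) ^ (j + 1)) • a) U) j := by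
      funext z μ
      rw [shiftCfg_apply, avgIter_shiftCfg L U j ((L : ℤ) • a) z μ, smul_smul, ← pow_succ]
    have hT : bgT L U j (y + a) (x + (L : ℤ) • a) = bgT L (shiftCfg (((L : ℤ) ^ (j + 1)) • a) U) j y x := by
      show hol (avgIter L U j) (blockBase L (y + a)) (treeWord (x + (L : ℤ) • a - blockBase L (y + a)))
        = hol (avgIter L (shiftCfg (((L : ℤ) ^ (j + 1)) • a) U) j) (blockBase L y) (treeWord (x - blockBase L y))
      have hb : blockBase L (y + a) = blockBase L y + (L : ℤ) • a := by
        funext i; simp only [blockBase, Pi.add_apply, Pi.smul_apply, smul_eq_mul]; ring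
      rw [hb, show x + (L : ℤ) • a - (blockBase L y + (L : ℤ) • a) = x - blockBase L y by abel, ← hol_shiftCfg, hW]
    rw [hT, QprimeIter_bgT_add U j ((L : ℤ) • a) h x, smul_smul, ← pow_succ]

omit [NormOneClass 𝔸] in
/-- ★ **PERIODICITY**: if the background and the argument are `Lᵏ•a`-periodic on the fine lattice then `Q′_k h` is `a`-periodic on the level-`k` lattice (at the member: `a ∈ N_k ℤ³`,
`Lᵏ·N_k = N₀` the period of the based pullback, lit ✓`pull_shiftCfg_period`). [cite: Balaban1987RG1, (0.1) p.251; Balaban1985BackgroundPropagators, (3.19) p.393] -/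
theorem QprimeIter_bgT_add_of_periodic (U : LSite d → Fin d → 𝔸ˣ) (k : ℕ) (a : LSite d) (h : LSite d → 𝔸)
    (hU : shiftCfg (((L : ℤ) ^ k) • a) U = U) (hh : shiftCfg (((L : ℤ) ^ k) • a) h = h) (y : LSite d) :
    QprimeIter (zdBlocking d L) (bgT L U) k h (y + a) = QprimeIter (zdBlocking d L) (bgT L U) k h y := by
  rw [QprimeIter_bgT_add, hU, hh]

/-! ## §2 The exact coset match and the datum bound -/

omit [NormOneClass 𝔸] [CompleteSpace 𝔸] in
include hL in
/-- ★★★ **THE COMPETITOR HAS THE SAME `k`-FOLD AVERAGES — EXACTLY.**  Data: a real bump `φ`, comb rotations `σ : LSite d → LSite d → 𝔸ˣ` (block label, site), a field `g`, and FREE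
`Minv ν G` with: `hMinv` «`M_y(Minv y X) = X`» where `M_y X := (Q′_k(φ•R(σ_y)⁻¹X))(y)`, `hν` «`ν y = Minv y (Q′_k g)(y)`», `hG` «`G x = φ x • R(σ_{y(x)} x)⁻¹ ν(y(x))`», `y(x) = ⌊x∕Lᵏ⌋`.
Then `(Q′_k G)(y) = (Q′_k g)(y)` for every `y` — by locality `Q′_k G` at `y` is `M_y(ν y)`. [cite: Balaban1985BackgroundPropagators, (3.19) p.393, (3.21) p.394] -/
theorem QprimeIter_competitor_eq (k : ℕ) (φ : LSite d → ℝ) (σ : LSite d → LSite d → 𝔸ˣ) (g : LSite d → 𝔸)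
    (Minv : LSite d → 𝔸 → 𝔸) (ν : LSite d → 𝔸) (G : LSite d → 𝔸)
    (hMinv : ∀ (y : LSite d) (X : 𝔸), QprimeIter (zdBlocking d L) T k (fun x => φ x • conjR (σ y x)⁻¹ (Minv y X)) y = X)
    (hν : ∀ y, ν y = Minv y (QprimeIter (zdBlocking d L) T k g y))
    (hG : ∀ x, G x = φ x • conjR (σ (blockMap (L ^ k) x) x)⁻¹ (ν (blockMap (L ^ k) x))) (y : LSite d) :
    QprimeIter (zdBlocking d L) T k G y = QprimeIter (zdBlocking d L) T k g y := by
  haveI : NeZero (L ^ k) := ⟨(pow_pos hL k).ne'⟩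
  have hloc : QprimeIter (zdBlocking d L) T k G y = QprimeIter (zdBlocking d L) T k (fun x => φ x • conjR (σ y x)⁻¹ (Minv y (QprimeIter (zdBlocking d L) T k g y))) y := by
    refine QprimeIter_congr_of_eqOn_blockSites hL T k y fun x hx => ?_
    rw [mem_blockSites_iff] at hx
    rw [hG, hx, hν]
  rw [hloc, hMinv]

omit [NormOneClass 𝔸] [CompleteSpace 𝔸] in
include hL in
/-- … hence `Q′_k(G − g) = 0` at every level-`k` site — the competitor row's first clause in px12 g5's door `div_sq_le_of_competitorRow` (read with `G − g♯` on the pullback).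
[cite: Balaban1985BackgroundPropagators, (3.19) p.393, (3.21) p.394] -/
theorem QprimeIter_competitor_sub_eq_zero (k : ℕ) (φ : LSite d → ℝ) (σ : LSite d → LSite d → 𝔸ˣ) (g : LSite d → 𝔸)
    (Minv : LSite d → 𝔸 → 𝔸) (ν : LSite d → 𝔸) (G : LSite d → 𝔸)
    (hMinv : ∀ (y : LSite d) (X : 𝔸), QprimeIter (zdBlocking d L) T k (fun x => φ x • conjR (σ y x)⁻¹ (Minv y X)) y = X)
    (hν : ∀ y, ν y = Minv y (QprimeIter (zdBlocking d L) T k g y))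
    (hG : ∀ x, G x = φ x • conjR (σ (blockMap (L ^ k) x) x)⁻¹ (ν (blockMap (L ^ k) x))) (y : LSite d) :
    QprimeIter (zdBlocking d L) T k (fun x => G x - g x) y = 0 := by
  have h := QprimeIter_competitor_eq hL T k φ σ g Minv ν G hMinv hν hG y
  have hsub : (fun x => G x - g x) = fun x => G x + ((-1 : ℂ) • g x) := by
    funext x; rw [neg_one_smul, sub_eq_add_neg]
  rw [hsub, QprimeIter_add, QprimeIter_smul]
  show QprimeIter (zdBlocking d L) T k G y + (-1 : ℂ) • QprimeIter (zdBlocking d L) T k g y = 0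
  rw [h, neg_one_smul, add_neg_cancel]

omit [CompleteSpace 𝔸] in
include hL in
/-- ★ **THE DATUM IS BOUNDED BY THE BLOCK MEANS**: with `‖Minv y X‖ ≤ μ‖X‖` and `U1` transporters, `‖ν y‖ ≤ μ·(L⁻ᵈ)ᵏ·Σ_{x∈Bᵏ(y)}‖g x‖`. [cite: Balaban1985BackgroundPropagators, (3.19) p.393] -/
theorem norm_datum_le (hT1 : ∀ j z x', T j z x' ∈ U1 𝔸) (k : ℕ) (g : LSite d → 𝔸) (Minv : LSite d → 𝔸 → 𝔸) (ν : LSite d → 𝔸) {μ : ℝ} (hμ : 0 ≤ μ)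
    (hMinvle : ∀ (y : LSite d) (X : 𝔸), ‖Minv y X‖ ≤ μ * ‖X‖) (hν : ∀ y, ν y = Minv y (QprimeIter (zdBlocking d L) T k g y)) (y : LSite d) :
    ‖ν y‖ ≤ μ * ((((L : ℝ) ^ d)⁻¹) ^ k * ∑ x ∈ blockSites (L ^ k) y, ‖g x‖) := by
  rw [hν]
  exact (hMinvle y _).trans (mul_le_mul_of_nonneg_left (norm_QprimeIter_le hL T hT1 g k y) hμ)

end Generic

/-! ## §3 The member: `M_y` as a continuous linear map with the Neumann hypothesis, at `U₀ ∈ RegPr(ε₀)` -/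

section Member

variable (F : T3Family) (n K : ℕ)

/-- ★★ **`M_y` PACKAGED, WITH `‖M_y − m•1‖ ≤ θ(d,L)·2ε₀·m`**: at `Ṽ := pull (bgUnits F K U₀) x₀`, `U₀ ∈ 𝔘_k(ε₀)` with print's windows, for every level-`k` site `y` (`k = K − n`) and real bump `φ ≥ 0`
there is a continuous linear `M : M₂(ℂ) →L[ℂ] M₂(ℂ)` with `M X = (Q′_k[Ṽ](φ•R(σ_y)⁻¹X))(y)` (`σ_y = axialFn Ṽ (Lᵏ•y)`) and `‖M − m•1‖ ≤ θ(d,L)·(2ε₀)·m`, `m = (L⁻ᵈ)ᵏΣ_{Bᵏ(y)}φ` — the hypothesis of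
the Neumann inversion (px19 ✓`exists_inverse_of_norm_sub_smul_one_le`: `‖M⁻¹‖ ≤ 2∕m` once `4θ(d,L)ε₀ ≤ 1`, `m > 0`), by ✓F2b (θ′) + (θ).
[cite: Balaban1985BackgroundPropagators, (3.19) p.393, (3.32) p.395; Balaban1985Averaging, Prop. 2 (52)–(54) p.26; Balaban1985Variational, (2) p.278] -/
theorem exists_clm_combAvg_axial_of_regPr {ε₀ : ℝ} (hε₀ : 0 < ε₀) (hε3 : C0 (F.P K).d * (2 * ε₀) ≤ 1 / 3) (hε2 : 2 * (2 * ε₀) ≤ c2' (F.P K).d (F.P K).L)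
    {U₀ : GaugeField (F.P K) 0 (Matrix.specialUnitaryGroup (Fin 2) ℂ)} (hreg : RegPr F n K ε₀ U₀) (x₀ : Site (F.P K) 0)
    (y : LSite (F.P K).d) (φ : LSite (F.P K).d → ℝ) (hφ : ∀ x, 0 ≤ φ x) :
    ∃ M : Matrix (Fin 2) (Fin 2) ℂ →L[ℂ] Matrix (Fin 2) (Fin 2) ℂ,
      (∀ X, M X = QprimeIter (zdBlocking (F.P K).d (F.P K).L) (bgT (F.P K).L (pull (bgUnits F K U₀) x₀)) (K - n)
          (fun x => φ x • conjR (axialFn (pull (bgUnits F K U₀) x₀) ((((F.P K).L : ℤ) ^ (K - n)) • y) x)⁻¹ X) y) ∧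
      ‖M - ((((((F.P K).L : ℝ) ^ (F.P K).d)⁻¹) ^ (K - n) * (∑ x ∈ blockSites ((F.P K).L ^ (K - n)) y, φ x) : ℝ) : ℂ) • (1 : Matrix (Fin 2) (Fin 2) ℂ →L[ℂ] Matrix (Fin 2) (Fin 2) ℂ)‖
        ≤ (2 * (F.P K).d * (F.P K).L * (256 * ((F.P K).d + 1) * ((F.P K).d + 4) + 1 + (F.P K).d * ((F.P K).L + 1))) * (2 * ε₀)
          * (((((F.P K).L : ℝ) ^ (F.P K).d)⁻¹) ^ (K - n) * ∑ x ∈ blockSites ((F.P K).L ^ (K - n)) y, φ x) := by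
  set V := pull (bgUnits F K U₀) x₀ with hV
  set L := (F.P K).L with hLdef
  set k := K - n with hk
  set σ := axialFn V (((L : ℤ) ^ k) • y) with hσ
  set m : ℝ := ((((L : ℝ) ^ (F.P K).d)⁻¹) ^ k * ∑ x ∈ blockSites (L ^ k) y, φ x) with hm
  set θ : ℝ := (2 * (F.P K).d * L * (256 * ((F.P K).d + 1) * ((F.P K).d + 4) + 1 + (F.P K).d * (L + 1))) * (2 * ε₀) with hθ
  -- the linear map
  let Lm : Matrix (Fin 2) (Fin 2) ℂ →ₗ[ℂ] Matrix (Fin 2) (Fin 2) ℂ :=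
    { toFun := fun X => QprimeIter (zdBlocking (F.P K).d L) (bgT L V) k (fun x => φ x • conjR (σ x)⁻¹ X) y
      map_add' := fun X Y => by
        have e : (fun x => φ x • conjR (σ x)⁻¹ (X + Y)) = fun x => (φ x • conjR (σ x)⁻¹ X) + (φ x • conjR (σ x)⁻¹ Y) := by
          funext x; rw [conjR_add, smul_add]
        simp only [e, QprimeIter_add]
      map_smul' := fun c X => by
        have e : (fun x => φ x • conjR (σ x)⁻¹ (c • X)) = fun x => c • (φ x • conjR (σ x)⁻¹ X) := by
          funext x; rw [conjR_smul, smul_comm]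
        simp only [e, QprimeIter_smul, RingHom.id_apply] }
  refine ⟨LinearMap.toContinuousLinearMap Lm, fun X => rfl, ?_⟩
  have hm0 : 0 ≤ m := mul_nonneg (pow_nonneg (by positivity) _) (Finset.sum_nonneg fun x _ => hφ x)
  have hθ0 : 0 ≤ θ := by rw [hθ]; positivity
  refine ContinuousLinearMap.opNorm_le_bound _ (mul_nonneg hθ0 hm0) fun X => ?_
  -- `(M − m•1) X = Q′_k[V₀](φ•X)(y) − m•X` by (θ′), bounded by (θ)
  have happ : ((LinearMap.toContinuousLinearMap Lm) - ((m : ℝ) : ℂ) • (1 : Matrix (Fin 2) (Fin 2) ℂ →L[ℂ] Matrix (Fin 2) (Fin 2) ℂ)) X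
      = QprimeIter (zdBlocking (F.P K).d L) (bgT L (gaugeAct σ V)) k (fun x => φ x • X) y - m • X := by
    change QprimeIter (zdBlocking (F.P K).d L) (bgT L V) k (fun x => φ x • conjR (σ x)⁻¹ X) y - ((m : ℝ) : ℂ) • X = _
    rw [Complex.coe_smul, hσ, ← QprimeIter_axial_eq_conjR F K L k V y φ X]
  rw [happ]
  exact norm_QprimeIter_axial_smul_sub_le_of_regPr F n K hε₀ hε3 hε2 hreg x₀ y φ hφ X

end Member

/-! ## §4 (v1.1 append) The norm and datum rows with transporters in `U1` BELOW LEVEL `k` ONLY (lit's `avgIter_mem` ∕ ✓`Prop7LandauCombDict.bgT_pull_mem_unitaryUnits_of_regPr`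
give the averaged transporters for `j ≤ k`; nothing is claimed above the top level) -/

section GenericLe

variable {𝔸 : Type*} [NormedRing 𝔸] [NormOneClass 𝔸] [NormedAlgebra ℂ 𝔸] [CompleteSpace 𝔸] {d : ℕ} {L : ℕ} (hL : 0 < L) (T : ℕ → LSite d → LSite d → 𝔸ˣ)

omit [CompleteSpace 𝔸] in
include hL in
/-- ★ `‖(Q′_j h)(z)‖ ≤ (L⁻ᵈ)ʲ·Σ_{x ∈ Bʲ(z)} ‖h(x)‖` for `j ≤ k`, assuming the transporters of levels `< k` lie in `U1`. [cite: Balaban1985BackgroundPropagators, (3.18)–(3.19) p.393] -/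
theorem norm_QprimeIter_le_of_le (k : ℕ) (hT1 : ∀ j < k, ∀ z x', T j z x' ∈ U1 𝔸) (h : LSite d → 𝔸) :
    ∀ (j : ℕ), j ≤ k → ∀ (z : LSite d), ‖QprimeIter (zdBlocking d L) T j h z‖ ≤ (((L : ℝ) ^ d)⁻¹) ^ j * ∑ x ∈ blockSites (L ^ j) z, ‖h x‖
  | 0, _, z => by
    haveI : NeZero (L ^ 0) := ⟨by simp⟩
    have hb : blockSites (1 : ℕ) z = {z} := by
      ext x; rw [mem_blockSites_iff, Finset.mem_singleton, Literature.MathematicalPhysics.QuantumLattice.blockMap_one]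
    simp [hb]
  | j + 1, hj, z => by
    rw [QprimeIter_succ]
    show ‖Qprime (blockSites L z) (fun _ => ((L : ℝ) ^ d)⁻¹) (T j z) (QprimeIter (zdBlocking d L) T j h)‖ ≤ _
    rw [Qprime_apply, show L ^ (j + 1) = L ^ j * L from pow_succ L j, sum_blockSites_mul (pow_pos hL j) hL z (fun x => ‖h x‖), pow_succ,
      Finset.mul_sum]
    refine (norm_sum_le _ _).trans (Finset.sum_le_sum fun x' _ => ?_)
    have hLd : (0 : ℝ) ≤ ((L : ℝ) ^ d)⁻¹ := by positivity
    rw [norm_smul, Real.norm_of_nonneg hLd]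
    calc ((L : ℝ) ^ d)⁻¹ * ‖conjR (T j z x') (QprimeIter (zdBlocking d L) T j h x')‖
        ≤ ((L : ℝ) ^ d)⁻¹ * ((((L : ℝ) ^ d)⁻¹) ^ j * ∑ x ∈ blockSites (L ^ j) x', ‖h x‖) :=
          mul_le_mul_of_nonneg_left ((B8Ineq132.norm_conjR_le (hT1 j (Nat.lt_of_succ_le hj) z x') _).trans
            (norm_QprimeIter_le_of_le k hT1 h j (Nat.le_of_succ_le hj) x')) hLd
      _ = _ := by ring

omit [CompleteSpace 𝔸] in
include hL in
/-- ★ **THE DATUM ROW with transporters in `U1` below level `k`**: `‖ν y‖ ≤ μ·(L⁻ᵈ)ᵏ·Σ_{x∈Bᵏ(y)}‖g x‖` — px19's F1-core v1.1 `competitor_energy_le_of_datumRow` ∕ (b-T)₂ `hν`, with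
`hT1` dischargeable by ✓`Prop7LandauCombDict.bgT_pull_mem_unitaryUnits_of_regPr` (+ lit `unitaryUnits_le_U1`). [cite: Balaban1985BackgroundPropagators, (3.19) p.393] -/
theorem norm_datum_le_of_le (k : ℕ) (hT1 : ∀ j < k, ∀ z x', T j z x' ∈ U1 𝔸) (g : LSite d → 𝔸) (Minv : LSite d → 𝔸 → 𝔸) (ν : LSite d → 𝔸)
    {μ : ℝ} (hμ : 0 ≤ μ) (hMinvle : ∀ (y : LSite d) (X : 𝔸), ‖Minv y X‖ ≤ μ * ‖X‖)
    (hν : ∀ y, ν y = Minv y (QprimeIter (zdBlocking d L) T k g y)) (y : LSite d) :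
    ‖ν y‖ ≤ μ * ((((L : ℝ) ^ d)⁻¹) ^ k * ∑ x ∈ blockSites (L ^ k) y, ‖g x‖) := by
  rw [hν]
  exact (hMinvle y _).trans (mul_le_mul_of_nonneg_left (norm_QprimeIter_le_of_le hL T k hT1 g k le_rfl y) hμ)

end GenericLe

end Summit.QuantumFields.YangMills.Theorems.Prop7CombCompetitorPullback

end
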